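import Literature.Analysis.FluidPDE.BoundedMildAncientPressureSublinear
import Literature.Analysis.FluidPDE.ClassicalSolutionGalilean
import Literature.Analysis.FluidPDE.ClassicalSolutionGalileanLocal
import HarnessLib

/-!
# SUBLINEAR PRESSURE GAUGE ⟺ INERTIAL FRAME (conditional on a smooth drift)

Analysis/FluidPDE proof file (all results proved, standard axioms), companion of `BoundedMildAncientPressureLogGrowth.lean` /
`BoundedMildAncientPressureSublinear.lean`.  Setting (extended Galilean covariance, Majda–Bertozzi 2002 §1.2; the tree's
`IsClassicalNSSolutionOn.galileanBoost`): `(u, p)` classical on `t < 0` and `ξ : ℝ → ℝ³` a SMOOTH frame path such that the boosted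
field `V(t, y) = u(t, y + ξ(t)) − ξ′(t)` — the INERTIAL REPRESENTATIVE — is bounded and Oseen-mild (KNSS) on `t < 0`.  The boosted
pressure `Q(t, y) = p(t, y + ξ(t)) + ⟪ξ″(t), y⟫` is a classical pressure of `V`, hence SUBLINEAR at infinity on every slice
(`pressure_sublinear_of_bounded_oseenMild`, Seregin 2014 Def. 6.3 / Lemma 6.5), and `p(t, x) = Q(t, x − ξ(t)) − ⟪ξ″(t), x − ξ(t)⟫`.
THEOREM ★ `pressure_sublinear_iff_frameAccel_eq_zero`: for every `t < 0`,
`p(t, ·)` is sublinear at infinity  IFF  `ξ″(t) = 0`.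
So, for the drifting members `u = V(·, · − ξ) + ξ′` of the bounded ancient class (the accelerated rest frames of KNSS 2009 §1, p. 3,
`V ≡ 0`), the W1 custodians' gauge hypothesis «every slice pressure is sublinear at infinity» (`IsSublinearAtInfinity (p t)`,
HorizonTower sketch v5, scope gap C′) holds EXACTLY in the inertial frames (`ξ″ ≡ 0`): «sublinear gauge = inertial frame».

CONDITIONAL / HONEST SCOPE: the drift `ξ` is ASSUMED `C^∞` (the tree's Oseen-gauge representation
`oseen_gauge_of_aestronglyMeasurable` of a general bounded ancient duality-mild solution yields only a continuous drift and an a.e.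
identity; upgrading it for classical `u` is a separate item).  Helpers: `sublinear_comp_sub_const`, `sublinear_sub`,
`eq_zero_of_sublinear_inner_sub` (a sublinear affine function has zero slope).
LOCAL FORM ★ `pressure_sublinear_iff_frameAccel_eq_zero_of_contDiffOn`: the same equivalence with the drift smooth only on the
life span `t < 0` (`ContDiffOn ℝ ∞ ξ (Iio 0)`; the honest drift of an ancient solution may blow up as `t → 0⁻`), through the tree's
localised covariance `IsClassicalNSSolutionOn.galileanBoostOn` — the form consumed by the drift-regularity theorem for classical
members of the class (Summits-side `TypeILiouvilleTypeIliouvilleLInertialGaugeClassical`).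

## References

* A. J. Majda, A. L. Bertozzi, *Vorticity and Incompressible Flow*, CUP 2002, §1.2 (Galilean invariance). [MajdaBertozzi2002]
* G. Seregin, *Lecture Notes on Regularity Theory for the Navier–Stokes Equations*, World Scientific 2014, §6.2 Remarks 6.2–6.4, Lemma 6.5,
  §6.3 Def. 6.3. [Seregin2014]
* G. Koch, N. Nadirashvili, G. Seregin, V. Šverák, Acta Math. 203 (2009), §1 p. 3 (parasitic solutions `b(t)`, pressure `−b′(t)·x`).
  [KochNadirashviliSereginSverak2009]

WHAT THIS IS NOT: not a claim about NS regularity or the Liouville conjecture.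
-/

noncomputable section

open Set Function
open _root_.Topology
open scoped RealInnerProductSpace ContDiff

namespace Literature.Analysis.FluidPDE

section PressureGauge

/-- Sublinearity at infinity is invariant under translation of the argument: if `|f y| ≤ ε‖y‖` far out for every `ε`, then the same
holds for `x ↦ f (x − a)`. [folklore] -/
private theorem sublinear_comp_sub_const {f : EuclideanSpace ℝ (Fin 3) → ℝ}
    (hf : ∀ ε : ℝ, 0 < ε → ∃ R : ℝ, ∀ y : EuclideanSpace ℝ (Fin 3), R ≤ ‖y‖ → |f y| ≤ ε * ‖y‖)
    (a : EuclideanSpace ℝ (Fin 3)) :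
    ∀ ε : ℝ, 0 < ε → ∃ R : ℝ, ∀ x : EuclideanSpace ℝ (Fin 3), R ≤ ‖x‖ → |f (x - a)| ≤ ε * ‖x‖ := by
  intro ε hε
  obtain ⟨R, hR⟩ := hf (ε / 2) (by positivity)
  refine ⟨max (R + ‖a‖) ‖a‖, fun x hx => ?_⟩
  have h1 : R + ‖a‖ ≤ ‖x‖ := (le_max_left _ _).trans hx
  have h2 : ‖a‖ ≤ ‖x‖ := (le_max_right _ _).trans hx
  have hxa : R ≤ ‖x - a‖ := by
    have := norm_sub_norm_le x a
    have h3 : ‖x‖ - ‖a‖ ≤ ‖x - a‖ := by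
      have := norm_le_norm_add_norm_sub' x a  -- ‖x‖ ≤ ‖a‖ + ‖x - a‖
      linarith
    linarith
  have hle : ‖x - a‖ ≤ ‖x‖ + ‖a‖ := norm_sub_le x a
  calc |f (x - a)| ≤ ε / 2 * ‖x - a‖ := hR _ hxa
    _ ≤ ε / 2 * (‖x‖ + ‖a‖) := mul_le_mul_of_nonneg_left hle (by positivity)
    _ ≤ ε * ‖x‖ := by nlinarith

/-- The difference of two functions sublinear at infinity is sublinear at infinity. [folklore] -/
private theorem sublinear_sub {f g : EuclideanSpace ℝ (Fin 3) → ℝ}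
    (hf : ∀ ε : ℝ, 0 < ε → ∃ R : ℝ, ∀ y : EuclideanSpace ℝ (Fin 3), R ≤ ‖y‖ → |f y| ≤ ε * ‖y‖)
    (hg : ∀ ε : ℝ, 0 < ε → ∃ R : ℝ, ∀ y : EuclideanSpace ℝ (Fin 3), R ≤ ‖y‖ → |g y| ≤ ε * ‖y‖) :
    ∀ ε : ℝ, 0 < ε → ∃ R : ℝ, ∀ y : EuclideanSpace ℝ (Fin 3), R ≤ ‖y‖ → |f y - g y| ≤ ε * ‖y‖ := by
  intro ε hε
  obtain ⟨R₁, hR₁⟩ := hf (ε / 2) (by positivity)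
  obtain ⟨R₂, hR₂⟩ := hg (ε / 2) (by positivity)
  refine ⟨max R₁ R₂, fun y hy => ?_⟩
  have h1 := hR₁ y ((le_max_left _ _).trans hy)
  have h2 := hR₂ y ((le_max_right _ _).trans hy)
  calc |f y - g y| ≤ |f y| + |g y| := abs_sub _ _
    _ ≤ ε / 2 * ‖y‖ + ε / 2 * ‖y‖ := add_le_add h1 h2
    _ = ε * ‖y‖ := by ring

/-- **A sublinear affine function has zero slope**: if `x ↦ ⟪w, x − a⟫` is sublinear at infinity then `w = 0` (test along `x = s w`).
[cite: KochNadirashviliSereginSverak2009, §1 p. 3 (the parasitic pressures −b′(t)·x are linear, not sublinear)] -/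
theorem eq_zero_of_sublinear_inner_sub {w a : EuclideanSpace ℝ (Fin 3)}
    (h : ∀ ε : ℝ, 0 < ε → ∃ R : ℝ, ∀ x : EuclideanSpace ℝ (Fin 3), R ≤ ‖x‖ → |⟪w, x - a⟫| ≤ ε * ‖x‖) : w = 0 := by
  by_contra hw
  have hwpos : 0 < ‖w‖ := norm_pos_iff.2 hw
  obtain ⟨R, hR⟩ := h (‖w‖ / 2) (by positivity)
  -- test point `x = s • w` with `s` large
  set s : ℝ := (max R 0 + 1) / ‖w‖ + (2 * |⟪w, a⟫| + 1) / ‖w‖ ^ 2 with hs_def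
  have hs : 0 < s := by rw [hs_def]; positivity
  have hnorm : ‖s • w‖ = s * ‖w‖ := by rw [norm_smul, Real.norm_eq_abs, abs_of_pos hs]
  have hxR : R ≤ ‖s • w‖ := by
    rw [hnorm, hs_def, add_mul, div_mul_cancel₀ _ hwpos.ne']
    have h0 : 0 ≤ (2 * |⟪w, a⟫| + 1) / ‖w‖ ^ 2 * ‖w‖ := by positivity
    linarith [le_max_left R 0]
  have h1 := hR (s • w) hxR
  rw [inner_sub_right, inner_smul_right, real_inner_self_eq_norm_sq, hnorm] at h1
  -- `|s‖w‖² − ⟪w,a⟫| ≤ (‖w‖/2) s ‖w‖` contradicts the choice of `s`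
  have h2 : s * ‖w‖ ^ 2 - |⟪w, a⟫| ≤ ‖w‖ / 2 * (s * ‖w‖) := by
    have := abs_sub_abs_le_abs_sub (s * ‖w‖ ^ 2) ⟪w, a⟫
    rw [abs_of_pos (by positivity : 0 < s * ‖w‖ ^ 2)] at this
    linarith
  have h3 : s * ‖w‖ ^ 2 / 2 ≤ |⟪w, a⟫| := by nlinarith
  have h4 : (2 * |⟪w, a⟫| + 1) / ‖w‖ ^ 2 ≤ s := by
    rw [hs_def]
    have : 0 ≤ (max R 0 + 1) / ‖w‖ := by positivity
    linarith
  have h5 : 2 * |⟪w, a⟫| + 1 ≤ s * ‖w‖ ^ 2 := by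
    have := (div_le_iff₀ (by positivity : (0 : ℝ) < ‖w‖ ^ 2)).1 h4
    linarith
  linarith

/-- ★ **SUBLINEAR PRESSURE GAUGE ⟺ INERTIAL FRAME** (conditional on a SMOOTH drift).  Let `(u, p)` be a classical solution of the
Navier–Stokes system (ν = 1, no force) on `t < 0`, and `ξ` a smooth frame path such that the inertial representative
`V(t, y) = u(t, y + ξ t) − ξ′(t)` is bounded on `t < 0` and satisfies the Oseen–Duhamel (KNSS-mild) formula between all pairs of
negative times.  Then for every `t < 0`: the slice pressure `p(t, ·)` is sublinear at infinity (`∀ ε > 0, ∃ R, ∀ x, R ≤ ‖x‖ →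
|p t x| ≤ ε ‖x‖`, the W1 custodians' `IsSublinearAtInfinity (p t)`) IF AND ONLY IF the frame acceleration vanishes, `ξ″(t) = 0`.
(Extended Galilean covariance `IsClassicalNSSolutionOn.galileanBoost` makes `Q(t,y) = p(t, y + ξ t) + ⟪ξ″ t, y⟫` a classical pressure of
`V`, sublinear by `pressure_sublinear_of_bounded_oseenMild`; and `p(t,x) = Q(t, x − ξ t) − ⟪ξ″ t, x − ξ t⟫`.)
[cite: MajdaBertozzi2002, §1.2 (Galilean invariance); Seregin2014, §6.3 Def. 6.3 + §6.2 Remark 6.4, Lemma 6.5] -/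
theorem pressure_sublinear_iff_frameAccel_eq_zero (M : ℝ)
    (u : ℝ → EuclideanSpace ℝ (Fin 3) → EuclideanSpace ℝ (Fin 3)) (p : ℝ → EuclideanSpace ℝ (Fin 3) → ℝ)
    (ξ : ℝ → EuclideanSpace ℝ (Fin 3))
    (hcl : IsClassicalNSSolutionOn (Set.Iio 0) 1 0 u p) (hξ : ContDiff ℝ ∞ ξ)
    (hbd : ∀ t < 0, ∀ y, ‖u t (y + ξ t) - deriv ξ t‖ ≤ M)
    (hmild : ∀ s t : ℝ, s < t → t < 0 → ∀ y, u t (y + ξ t) - deriv ξ t =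
      UnboundedOperators.heatExtension (fun z => u s (z + ξ s) - deriv ξ s) (t - s) y -
        oseenDuhamel 1 s (fun τ z => u τ (z + ξ τ) - deriv ξ τ) (fun τ z => u τ (z + ξ τ) - deriv ξ τ) t y) :
    ∀ t < 0, ((∀ ε : ℝ, 0 < ε → ∃ R : ℝ, ∀ x : EuclideanSpace ℝ (Fin 3), R ≤ ‖x‖ → |p t x| ≤ ε * ‖x‖) ↔
      deriv (deriv ξ) t = 0) := by
  -- the boosted (inertial) pair
  set V : ℝ → EuclideanSpace ℝ (Fin 3) → EuclideanSpace ℝ (Fin 3) := fun t y => u t (y + ξ t) - deriv ξ t with hV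
  set Q : ℝ → EuclideanSpace ℝ (Fin 3) → ℝ := fun t y => p t (y + ξ t) + ⟪deriv (deriv ξ) t, y⟫ - (fun _ : ℝ => (0 : ℝ)) t
    with hQ
  have hclV : IsClassicalNSSolutionOn (Set.Iio 0) 1 0 V Q :=
    hcl.galileanBoost_zero (uniqueDiffOn_Iio 0) hξ (g := fun _ => (0 : ℝ)) contDiff_const
  have hcontV : ContinuousOn (Function.uncurry V) (Set.Iio (0 : ℝ) ×ˢ Set.univ) := hclV.smooth_velocity.continuousOn
  have hbdV : ∀ t < 0, ∀ y, ‖V t y‖ ≤ M := hbd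
  have hmildV : ∀ s t : ℝ, s < t → t < 0 → ∀ y, V t y =
      UnboundedOperators.heatExtension (V s) (t - s) y - oseenDuhamel 1 s V V t y := hmild
  have hdivV : ∀ t < 0, VectorCalculus.IsDivFree (V t) := fun t ht => hclV.divFree t ht
  -- the boosted pressure is sublinear on every slice
  have hQsub := pressure_sublinear_of_bounded_oseenMild M V Q hbdV hcontV hmildV hdivV hclV
  intro t ht
  -- `p(t,x) = Q(t, x − ξ t) − ⟪ξ″ t, x − ξ t⟫`
  have hpQ : ∀ x, p t x = Q t (x - ξ t) - ⟪deriv (deriv ξ) t, x - ξ t⟫ := by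
    intro x; simp only [hQ, sub_add_cancel, sub_zero]; ring
  have hQt := sublinear_comp_sub_const (hQsub t ht) (ξ t)
  constructor
  · -- `p(t,·)` sublinear ⇒ the affine part is sublinear ⇒ `ξ″ t = 0`
    intro hp
    have haff : ∀ ε : ℝ, 0 < ε → ∃ R : ℝ, ∀ x : EuclideanSpace ℝ (Fin 3), R ≤ ‖x‖ →
        |⟪deriv (deriv ξ) t, x - ξ t⟫| ≤ ε * ‖x‖ := by
      have h := sublinear_sub hQt hp
      intro ε hε
      obtain ⟨R, hR⟩ := h ε hε
      refine ⟨R, fun x hx => ?_⟩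
      have h1 := hR x hx
      rwa [hpQ x, sub_sub_cancel] at h1
    exact eq_zero_of_sublinear_inner_sub haff
  · -- `ξ″ t = 0` ⇒ `p(t,·) = Q(t, · − ξ t)` is sublinear
    intro h0 ε hε
    obtain ⟨R, hR⟩ := hQt ε hε
    refine ⟨R, fun x hx => ?_⟩
    rw [hpQ x, h0, inner_zero_left, sub_zero]
    exact hR x hx

/-- ★ **SUBLINEAR PRESSURE GAUGE ⟺ INERTIAL FRAME, drift smooth on the life span only.**  Same statement as
`pressure_sublinear_iff_frameAccel_eq_zero` with the frame path `ξ` assumed `C^∞` on `t < 0` only (`ContDiffOn ℝ ∞ ξ (Iio 0)`):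
for `(u, p)` classical on `t < 0` (ν = 1, no force) whose inertial representative `V(t, y) = u(t, y + ξ t) − ξ′(t)` is bounded and
Oseen–Duhamel (KNSS) mild between all pairs of negative times, for every `t < 0` the slice pressure `p(t, ·)` is sublinear at
infinity IFF `ξ″(t) = 0`.  (Localised extended Galilean covariance `IsClassicalNSSolutionOn.galileanBoostOn` with `U = S = Iio 0`;
then verbatim: `Q(t,y) = p(t, y + ξ t) + ⟪ξ″ t, y⟫` is a classical pressure of `V`, sublinear by
`pressure_sublinear_of_bounded_oseenMild`, and `p(t,x) = Q(t, x − ξ t) − ⟪ξ″ t, x − ξ t⟫`.)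
[cite: MajdaBertozzi2002, §1.2 (Galilean invariance); Seregin2014, §6.3 Def. 6.3 + §6.2 Remark 6.4, Lemma 6.5] -/
theorem pressure_sublinear_iff_frameAccel_eq_zero_of_contDiffOn (M : ℝ)
    (u : ℝ → EuclideanSpace ℝ (Fin 3) → EuclideanSpace ℝ (Fin 3)) (p : ℝ → EuclideanSpace ℝ (Fin 3) → ℝ)
    (ξ : ℝ → EuclideanSpace ℝ (Fin 3))
    (hcl : IsClassicalNSSolutionOn (Set.Iio 0) 1 0 u p) (hξ : ContDiffOn ℝ ∞ ξ (Set.Iio 0))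
    (hbd : ∀ t < 0, ∀ y, ‖u t (y + ξ t) - deriv ξ t‖ ≤ M)
    (hmild : ∀ s t : ℝ, s < t → t < 0 → ∀ y, u t (y + ξ t) - deriv ξ t =
      UnboundedOperators.heatExtension (fun z => u s (z + ξ s) - deriv ξ s) (t - s) y -
        oseenDuhamel 1 s (fun τ z => u τ (z + ξ τ) - deriv ξ τ) (fun τ z => u τ (z + ξ τ) - deriv ξ τ) t y) :
    ∀ t < 0, ((∀ ε : ℝ, 0 < ε → ∃ R : ℝ, ∀ x : EuclideanSpace ℝ (Fin 3), R ≤ ‖x‖ → |p t x| ≤ ε * ‖x‖) ↔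
      deriv (deriv ξ) t = 0) := by
  -- the boosted (inertial) pair
  set V : ℝ → EuclideanSpace ℝ (Fin 3) → EuclideanSpace ℝ (Fin 3) := fun t y => u t (y + ξ t) - deriv ξ t with hV
  set Q : ℝ → EuclideanSpace ℝ (Fin 3) → ℝ := fun t y => p t (y + ξ t) + ⟪deriv (deriv ξ) t, y⟫ - (fun _ : ℝ => (0 : ℝ)) t
    with hQ
  have hclV : IsClassicalNSSolutionOn (Set.Iio 0) 1 0 V Q :=
    hcl.galileanBoostOn (uniqueDiffOn_Iio 0) isOpen_Iio Subset.rfl hξ (g := fun _ => (0 : ℝ)) contDiffOn_const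
  have hcontV : ContinuousOn (Function.uncurry V) (Set.Iio (0 : ℝ) ×ˢ Set.univ) := hclV.smooth_velocity.continuousOn
  have hbdV : ∀ t < 0, ∀ y, ‖V t y‖ ≤ M := hbd
  have hmildV : ∀ s t : ℝ, s < t → t < 0 → ∀ y, V t y =
      UnboundedOperators.heatExtension (V s) (t - s) y - oseenDuhamel 1 s V V t y := hmild
  have hdivV : ∀ t < 0, VectorCalculus.IsDivFree (V t) := fun t ht => hclV.divFree t ht
  -- the boosted pressure is sublinear on every slice
  have hQsub := pressure_sublinear_of_bounded_oseenMild M V Q hbdV hcontV hmildV hdivV hclV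
  intro t ht
  -- `p(t,x) = Q(t, x − ξ t) − ⟪ξ″ t, x − ξ t⟫`
  have hpQ : ∀ x, p t x = Q t (x - ξ t) - ⟪deriv (deriv ξ) t, x - ξ t⟫ := by
    intro x; simp only [hQ, sub_add_cancel, sub_zero]; ring
  have hQt := sublinear_comp_sub_const (hQsub t ht) (ξ t)
  constructor
  · -- `p(t,·)` sublinear ⇒ the affine part is sublinear ⇒ `ξ″ t = 0`
    intro hp
    have haff : ∀ ε : ℝ, 0 < ε → ∃ R : ℝ, ∀ x : EuclideanSpace ℝ (Fin 3), R ≤ ‖x‖ →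
        |⟪deriv (deriv ξ) t, x - ξ t⟫| ≤ ε * ‖x‖ := by
      have h := sublinear_sub hQt hp
      intro ε hε
      obtain ⟨R, hR⟩ := h ε hε
      refine ⟨R, fun x hx => ?_⟩
      have h1 := hR x hx
      rwa [hpQ x, sub_sub_cancel] at h1
    exact eq_zero_of_sublinear_inner_sub haff
  · -- `ξ″ t = 0` ⇒ `p(t,·) = Q(t, · − ξ t)` is sublinear
    intro h0 ε hε
    obtain ⟨R, hR⟩ := hQt ε hε
    refine ⟨R, fun x hx => ?_⟩
    rw [hpQ x, h0, inner_zero_left, sub_zero]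
    exact hR x hx

end PressureGauge

end Literature.Analysis.FluidPDE

end
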